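import Literature.NumberTheory.Transcendental.DiazMainIIIConstruction
import Literature.NumberTheory.Transcendental.DiazThm1Proofs
import HarnessLib

/-!
# Laurent's Théorème 3 iii) — the parameters as functions of `X`

Topic `Literature/NumberTheory/Transcendental`. Third step of the conditional proof of the large range
of `Diaz1989_main_iii` (`DiazMain.lean`; M. Laurent, Astérisque 198–200 (1991), §3.1, Théorème 3
iii); Diaz 1989 / Philippon 1986, Thm 2.12 (i)) from `Philippon1986_mainCriterion` and
`Philippon1986_GaGm`: the choice of the parameters of Gel'fond's method WITH derivatives
(`DiazMainIIIConstruction.lean`: `n` frequencies `yᵢ`, `m` points `x_k`) as functions of a large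
real `X`, and the elementary eventual inequalities they satisfy — the analogue of Diaz's §II-4-1
(`DiazParams.lean`) for the multiplicity case; the choices are ours (there is no printed model):

`M = [X]` (Siegel's box of points), `L = [X^{m/n}]` (frequencies), `S = LM` (orders), `D = a_D S`
(degree in `z`, `a_D = 2^{#Var+n+1}`), `b = c_b S` (box of the coefficient polynomials,
`c_b = 1 + a_D + nm`, so that Siegel's degree margin `S + D + nmLM` equals `b`, `delta_eq`),
`B = a_B M`, `M₂ = (n+1)B` (box of the family; `a_B = 2^{m+n+4}(n+1)(c+1)a_D` with `c` the
constant of the zero lemma), `T = [(S-1)/(n+1)]`, `T₂ = (n+1)T < S` (orders of the family);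
scales `Ψ = X^{1+m/n+m} log X` (`≍ SM^m log X`, smallness), `Φ = X^{1+m/n} log X` (`≍ LM log X`,
degrees and heights), `ρ = 4Ψ` (the ball), and `H = #Unk (D+nL)^S(mM+1)^D` (Siegel's height).

PROVED: sandwiches (`eventually_M_ge`, `eventually_L_ge`, `M_le`, `L_le`, `scale_facts`), Siegel's
margin (𝒞1) `eventually_C1` (`2M^mS(2b)^{#Var} ≤ DLⁿb^{#Var}`), the two counting inequalities of the
zero lemma with multiplicities `eventually_counting₁/₂` (`cDLⁿ < (T+1)(B+1)^m`,
`cLⁿ < (T+1)(B+1)^{m-1}`), `T2_lt_S`, `S_le_T_succ`, `M_le_M2`, crude bounds `eventually_crude`,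
and `eventually_log_Hgt3_le` (`log H ≤ K_H Φ`). Everything here is proved; the definitions are
explicit numerals/floors.

## References

* M. Laurent, *Sur quelques résultats récents de transcendance*, Astérisque 198–200 (1991),
  §3.1, Théorème 3 iii), p. 213. [Laurent1991]
* G. Diaz, *Grands degrés de transcendance pour des familles d'exponentielles*, J. Number Theory
  31 (1989), 1–23, §II-4-1, p. 15 (the model, without multiplicities). [Diaz1989]
-/

noncomputable section

open Filter Real Finset
open Literature.NumberTheory.Transcendental.Asymp
open Literature.NumberTheory.Transcendental.ExpGrid (Var)
open Literature.NumberTheory.Transcendental.DiazThm1 (scale_zero_eq_exp)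

namespace Literature.NumberTheory.Transcendental

namespace DiazMainIII

/-! ### Constants -/

/-- `#Var = n + m + nm` letters. [folklore] -/
theorem card_Var (n m : ℕ) : Fintype.card (Var n m) = n + (m + n * m) := by
  simp [Fintype.card_sum, Fintype.card_prod]

/-- `a_D = 2^{#Var + n + 1}`: `D = a_D S` (Siegel's margin (𝒞1)). [folklore] -/
def aD (n m : ℕ) : ℕ := 2 ^ (Fintype.card (Var n m) + n + 1)

/-- `c_b = 1 + a_D + nm`: the box `b = c_b S` of the coefficient polynomials equals the degree
margin `Δ = S + D + nmLM`. [folklore] -/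
def cb (n m : ℕ) : ℕ := 1 + aD n m + n * m

/-- `a_B = 2^{m+n+4}(n+1)(c+1)a_D`: `B = a_B M` (the zero lemma's counting, `c` its constant).
[folklore] -/
def aB (n m c : ℕ) : ℕ := 2 ^ (m + n + 4) * (n + 1) * (c + 1) * aD n m

variable {n m : ℕ}

/-- `a_D ≥ 1`. [folklore] -/
theorem one_le_aD : 1 ≤ aD n m := Nat.one_le_two_pow

/-- `c_b ≥ 2`. [folklore] -/
theorem two_le_cb : 2 ≤ cb n m := by unfold cb; have := one_le_aD (n := n) (m := m); omega

/-- `a_B ≥ 1`. [folklore] -/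
theorem one_le_aB {c : ℕ} : 1 ≤ aB n m c := by
  unfold aB
  have h1 := one_le_aD (n := n) (m := m)
  have h2 : 1 ≤ 2 ^ (m + n + 4) := Nat.one_le_two_pow
  calc 1 = 1 * 1 * 1 * 1 := by ring
    _ ≤ 2 ^ (m + n + 4) * (n + 1) * (c + 1) * aD n m :=
        Nat.mul_le_mul (Nat.mul_le_mul (Nat.mul_le_mul h2 (Nat.le_add_left 1 n))
          (Nat.le_add_left 1 c)) h1

/-! ### Parameters -/

/-- `M = [X]` (Siegel's box of points). [folklore] -/
def Mq (X : ℝ) : ℕ := ⌊X⌋₊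

/-- `L = [X^{m/n}]` (box of frequencies). [folklore] -/
def Lq (n m : ℕ) (X : ℝ) : ℕ := ⌊scale ((m : ℝ) / n) 0 X⌋₊

/-- `S = LM` (order of vanishing in Siegel's step). [folklore] -/
def Sq (n m : ℕ) (X : ℝ) : ℕ := Lq n m X * Mq X

/-- `D = a_D S` (degree in `z`). [folklore] -/
def Dq (n m : ℕ) (X : ℝ) : ℕ := aD n m * Sq n m X

/-- `b = c_b S` (degree of the coefficient polynomials in each letter). [folklore] -/
def bq (n m : ℕ) (X : ℝ) : ℕ := cb n m * Sq n m X

/-- `B = a_B M` (the zero lemma's box is `(n+1)B`). [folklore] -/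
def Bq (n m c : ℕ) (X : ℝ) : ℕ := aB n m c * Mq X

/-- `M₂ = (n+1)B` (box of points of the family). [folklore] -/
def M2q (n m c : ℕ) (X : ℝ) : ℕ := (n + 1) * Bq n m c X

/-- `T = [(S-1)/(n+1)]` (the zero lemma's order is `(n+1)T`). [folklore] -/
def Tq (n m : ℕ) (X : ℝ) : ℕ := (Sq n m X - 1) / (n + 1)

/-- `T₂ = (n+1)T` (orders of the family). [folklore] -/
def T2q (n m : ℕ) (X : ℝ) : ℕ := (n + 1) * Tq n m X

/-- `Ψ(X) = X^{1+m/n+m} log X` (the smallness scale `≍ S M^m log X`). [folklore] -/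
def Psi3 (n m : ℕ) (X : ℝ) : ℝ := scale (1 + (m : ℝ) / n + m) 1 X

/-- `Φ(X) = X^{1+m/n} log X` (the degree/height scale `≍ LM log X`). [folklore] -/
def Phi3 (n m : ℕ) (X : ℝ) : ℝ := scale (1 + (m : ℝ) / n) 1 X

/-- `ρ(X) = 4Ψ(X)` (the ball has radius `e^{-ρ}`). [folklore] -/
def rho3 (n m : ℕ) (X : ℝ) : ℝ := 4 * Psi3 n m X

/-- The height bound `H = #Unk · (D + nL)^S (mM+1)^D` of Siegel's step (`exists_coeffs`). [folklore] -/
def Hgt3 (n m : ℕ) (X : ℝ) : ℝ :=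
  (Fintype.card (Unk n m (Dq n m X) (Lq n m X) (bq n m X)) : ℝ) *
    ((((Dq n m X : ℕ) : ℝ) + n * Lq n m X) ^ Sq n m X * ((m : ℝ) * Mq X + 1) ^ Dq n m X)

/-! ### Sandwiches -/

/-- `M ≤ X` (`X ≥ 0`). [folklore] -/
theorem M_le {X : ℝ} (hX : 0 ≤ X) : (Mq X : ℝ) ≤ X := Nat.floor_le hX

/-- `L ≤ X^{m/n}` (`X ≥ 1`). [folklore] -/
theorem L_le {X : ℝ} (hX : 1 ≤ X) : (Lq n m X : ℝ) ≤ scale ((m : ℝ) / n) 0 X :=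
  Nat.floor_le (scale_nonneg hX)

/-- Eventually `X/2 ≤ M ≤ X` and `M ≥ 2`. [folklore] -/
theorem eventually_M_ge : ∀ᶠ X in atTop, X / 2 ≤ (Mq X : ℝ) ∧ 2 ≤ Mq X := by
  filter_upwards [eventually_ge_atTop (4 : ℝ)] with X hX
  have hfl := Nat.lt_floor_add_one X
  have h1 : X / 2 ≤ (Mq X : ℝ) := by unfold Mq; linarith
  refine ⟨h1, ?_⟩
  have : (2 : ℝ) ≤ (Mq X : ℝ) := by linarith
  exact_mod_cast this

/-- Eventually `X^{m/n}/2 ≤ L` and `L ≥ 2` (`m, n ≥ 1`). [folklore] -/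
theorem eventually_L_ge (hn : 1 ≤ n) (hm : 1 ≤ m) :
    ∀ᶠ X in atTop, scale ((m : ℝ) / n) 0 X / 2 ≤ (Lq n m X : ℝ) ∧ 2 ≤ Lq n m X := by
  have hpos : (0 : ℝ) < (m : ℝ) / n := by
    have : (0 : ℝ) < m := by exact_mod_cast hm
    have : (0 : ℝ) < n := by exact_mod_cast hn
    positivity
  filter_upwards [eventually_const_le_scale (a := (m : ℝ) / n) (b := 0) (Or.inl hpos) 4] with X hX
  have hfl := Nat.lt_floor_add_one (scale ((m : ℝ) / n) 0 X)
  have h1 : scale ((m : ℝ) / n) 0 X / 2 ≤ (Lq n m X : ℝ) := by unfold Lq; linarith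
  refine ⟨h1, ?_⟩
  have : (2 : ℝ) ≤ (Lq n m X : ℝ) := by linarith
  exact_mod_cast this

/-- `X^{m/n}·X = X^{1+m/n}` and `(X^{m/n})ⁿ = X^m` (as scales, `X ≥ 1`). [folklore] -/
theorem scale_facts (hn : 1 ≤ n) {X : ℝ} (hX : 1 < X) :
    scale ((m : ℝ) / n) 0 X * X = scale (1 + (m : ℝ) / n) 0 X ∧
    scale ((m : ℝ) / n) 0 X ^ n = scale m 0 X := by
  constructor
  · have := scale_mul_scale (a := (m : ℝ) / n) (b := 0) (a' := 1) (b' := 0) hX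
    rw [scale_one_zero] at this
    rw [this]; ring_nf
  · rw [scale_pow hX.le]
    have hn0 : (n : ℝ) ≠ 0 := by exact_mod_cast (show n ≠ 0 by omega)
    congr 1
    · field_simp
    · simp

/-! ### (𝒞1): Siegel's margin -/

/-- The degree margin of `exists_coeffs` is the box: `S + D + nmLM = c_b S = b`. [folklore] -/
theorem delta_eq (X : ℝ) : Sq n m X + Dq n m X + n * m * Lq n m X * Mq X = bq n m X := by
  unfold bq Dq cb Sq; ring

/-- **(𝒞1) eventually**: `2 M^m S (b + Δ)^{#Var} ≤ D Lⁿ b^{#Var}`. [folklore] -/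
theorem eventually_C1 (hn : 1 ≤ n) (hm : 1 ≤ m) :
    ∀ᶠ X in atTop, 2 * (Mq X ^ m * (Sq n m X *
      (bq n m X + (Sq n m X + Dq n m X + n * m * Lq n m X * Mq X)) ^ Fintype.card (Var n m))) ≤
        Dq n m X * Lq n m X ^ n * bq n m X ^ Fintype.card (Var n m) := by
  filter_upwards [eventually_M_ge, eventually_L_ge (n := n) (m := m) hn hm,
    eventually_gt_atTop (1 : ℝ)] with X hM hL hX1
  rw [delta_eq, ← two_mul, mul_pow]
  -- reduce to `M^m ≤ 2ⁿ Lⁿ`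
  suffices h : Mq X ^ m ≤ 2 ^ n * Lq n m X ^ n by
    unfold Dq aD
    set V := Fintype.card (Var n m)
    calc 2 * (Mq X ^ m * (Sq n m X * (2 ^ V * bq n m X ^ V)))
        = 2 ^ (V + 1) * Mq X ^ m * Sq n m X * bq n m X ^ V := by rw [pow_succ]; ring
      _ ≤ 2 ^ (V + 1) * (2 ^ n * Lq n m X ^ n) * Sq n m X * bq n m X ^ V := by
          gcongr
      _ = 2 ^ (V + n + 1) * Sq n m X * Lq n m X ^ n * bq n m X ^ V := by
          rw [show V + n + 1 = (V + 1) + n by ring, pow_add]; ring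
  -- in `ℝ`: `M ≤ X`, `X^m = (X^{m/n})ⁿ ≤ (2L)ⁿ`
  have key : ((Mq X : ℕ) : ℝ) ^ m ≤ (2 : ℝ) ^ n * (Lq n m X : ℝ) ^ n := by
    have h2L : scale ((m : ℝ) / n) 0 X ≤ 2 * (Lq n m X : ℝ) := by linarith [hL.1]
    calc ((Mq X : ℕ) : ℝ) ^ m ≤ X ^ m := pow_le_pow_left₀ (Nat.cast_nonneg _) (M_le (by linarith)) m
      _ = scale m 0 X := by rw [scale]; simp [Real.rpow_natCast]
      _ = scale ((m : ℝ) / n) 0 X ^ n := ((scale_facts (m := m) hn hX1).2).symm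
      _ ≤ (2 * (Lq n m X : ℝ)) ^ n := pow_le_pow_left₀ (scale_nonneg hX1.le) h2L n
      _ = (2 : ℝ) ^ n * (Lq n m X : ℝ) ^ n := mul_pow _ _ _
  exact_mod_cast key

/-! ### Elementary facts at a good `X` -/

/-- `T₂ + 1 ≤ S` when `S ≥ 1`: the orders `t ≤ T₂` of the family are `< S`. [folklore] -/
theorem T2_lt_S {X : ℝ} (hS : 1 ≤ Sq n m X) : T2q n m X < Sq n m X := by
  unfold T2q Tq
  have := Nat.div_mul_le_self (Sq n m X - 1) (n + 1)
  rw [mul_comm] at this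
  omega

/-- `(T + 1)(n + 1) ≥ S`. [folklore] -/
theorem S_le_T_succ {X : ℝ} : Sq n m X ≤ (Tq n m X + 1) * (n + 1) := by
  unfold Tq
  have := Nat.lt_div_mul_add (a := Sq n m X - 1) (b := n + 1) (by omega)
  rw [add_mul, one_mul]
  omega

/-- `M ≤ M₂`. [folklore] -/
theorem M_le_M2 {c : ℕ} (X : ℝ) : Mq X ≤ M2q n m c X := by
  unfold M2q Bq
  have h1 := one_le_aB (n := n) (m := m) (c := c)
  calc Mq X = 1 * (1 * Mq X) := by ring
    _ ≤ (n + 1) * (aB n m c * Mq X) := Nat.mul_le_mul (by omega) (Nat.mul_le_mul_right _ h1)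


/-! ### The counting hypotheses of the zero lemma with multiplicities -/

/-- `(T+1) ≥ S/(n+1)` in `ℝ`. [folklore] -/
theorem S_div_le_T_succ (X : ℝ) : (Sq n m X : ℝ) / (n + 1) ≤ (Tq n m X : ℝ) + 1 := by
  have h := S_le_T_succ (n := n) (m := m) (X := X)
  have h' : (Sq n m X : ℝ) ≤ ((Tq n m X : ℝ) + 1) * (n + 1) := by exact_mod_cast h
  rw [div_le_iff₀ (by positivity)]
  exact h'

/-- **First counting inequality of `DiazZLM.zeroLemmaMult_of_GaGm`, eventually**:
`c D Lⁿ < (T+1)(B+1)^m` (`m, n ≥ 1`; `B = a_B M`, `a_B = 2^{m+n+4}(n+1)(c+1)a_D`). [folklore] -/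
theorem eventually_counting₁ (c : ℕ) (hn : 1 ≤ n) (hm : 1 ≤ m) :
    ∀ᶠ X in atTop, c * Dq n m X * Lq n m X ^ n < (Tq n m X + 1) * (Bq n m c X + 1) ^ m := by
  filter_upwards [eventually_M_ge, eventually_L_ge (n := n) (m := m) hn hm,
    eventually_gt_atTop (1 : ℝ)] with X hM hL hX1
  obtain ⟨hMX, hM2⟩ := hM
  obtain ⟨hLX, hL2⟩ := hL
  have hX0 : (0 : ℝ) < X := by linarith
  have hLle : (Lq n m X : ℝ) ≤ scale ((m : ℝ) / n) 0 X := L_le hX1.le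
  obtain ⟨-, hsc2⟩ := scale_facts (m := m) hn hX1
  have hXm : scale (m : ℝ) 0 X = X ^ m := by rw [scale]; simp [Real.rpow_natCast]
  have hLn : (Lq n m X : ℝ) ^ n ≤ X ^ m := by
    calc (Lq n m X : ℝ) ^ n ≤ scale ((m : ℝ) / n) 0 X ^ n := pow_le_pow_left₀ (Nat.cast_nonneg _) hLle n
      _ = X ^ m := by rw [hsc2, hXm]
  have hMm : (X / 2) ^ m ≤ (Mq X : ℝ) ^ m := pow_le_pow_left₀ (by positivity) hMX m
  have hS : (Sq n m X : ℝ) = Lq n m X * Mq X := by unfold Sq; push_cast; ring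
  have hM2r : (2 : ℝ) ≤ Mq X := by exact_mod_cast hM2
  have hL2r : (2 : ℝ) ≤ Lq n m X := by exact_mod_cast hL2
  have hSpos : (0 : ℝ) < Sq n m X := by rw [hS]; positivity
  have hT : (Sq n m X : ℝ) / (n + 1) ≤ (Tq n m X : ℝ) + 1 := S_div_le_T_succ X
  have haD1 : (1 : ℝ) ≤ aD n m := by exact_mod_cast one_le_aD (n := n) (m := m)
  have haB1 : (1 : ℝ) ≤ aB n m c := by exact_mod_cast one_le_aB (n := n) (m := m) (c := c)
  have haB : (aB n m c : ℝ) = 2 ^ (m + n + 4) * (n + 1) * (c + 1) * aD n m := by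
    unfold aB; push_cast; ring
  have hB1 : (aB n m c : ℝ) * Mq X ≤ (Bq n m c X : ℝ) + 1 := by
    have : (Bq n m c X : ℝ) = aB n m c * Mq X := by unfold Bq; push_cast; ring
    rw [this]; linarith
  have hD : (Dq n m X : ℝ) = aD n m * Sq n m X := by unfold Dq; push_cast; ring
  -- constants: `c a_D (n+1) 2^m < a_B`
  have hcc : (c : ℝ) * aD n m * (n + 1) * 2 ^ m < aB n m c := by
    rw [haB]
    have h24 : (2 : ℝ) ^ m ≤ 2 ^ (m + n + 4) := pow_le_pow_right₀ (by norm_num) (by omega)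
    have e1 : (2 : ℝ) ^ m * (n + 1) * (c + 1) * aD n m ≤ 2 ^ (m + n + 4) * (n + 1) * (c + 1) * aD n m := by
      gcongr
    have e2 : (2 : ℝ) ^ m * (n + 1) * (c + 1) * aD n m =
        (c : ℝ) * aD n m * (n + 1) * 2 ^ m + 2 ^ m * (n + 1) * aD n m := by ring
    have e3 : (0 : ℝ) < 2 ^ m * (n + 1) * aD n m := by positivity
    linarith
  -- `c a_D (n+1) Lⁿ < (a_B M)^m`
  have h1 : (c : ℝ) * aD n m * (n + 1) * (Lq n m X : ℝ) ^ n < ((aB n m c : ℝ) * Mq X) ^ m := by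
    have hlhs : (c : ℝ) * aD n m * (n + 1) * (Lq n m X : ℝ) ^ n ≤ (c : ℝ) * aD n m * (n + 1) * X ^ m :=
      mul_le_mul_of_nonneg_left hLn (by positivity)
    have hmid : (c : ℝ) * aD n m * (n + 1) * X ^ m < (aB n m c : ℝ) * (X / 2) ^ m := by
      rw [div_pow]
      have hXm0 : (0 : ℝ) < X ^ m / 2 ^ m := by positivity
      calc (c : ℝ) * aD n m * (n + 1) * X ^ m = ((c : ℝ) * aD n m * (n + 1) * 2 ^ m) * (X ^ m / 2 ^ m) := by
            field_simp
        _ < (aB n m c : ℝ) * (X ^ m / 2 ^ m) := mul_lt_mul_of_pos_right hcc hXm0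
    have hrhs : (aB n m c : ℝ) * (X / 2) ^ m ≤ ((aB n m c : ℝ) * Mq X) ^ m := by
      rw [mul_pow]
      calc (aB n m c : ℝ) * (X / 2) ^ m ≤ (aB n m c : ℝ) ^ m * (X / 2) ^ m := by
            refine mul_le_mul_of_nonneg_right ?_ (by positivity)
            calc (aB n m c : ℝ) = (aB n m c : ℝ) ^ 1 := (pow_one _).symm
              _ ≤ (aB n m c : ℝ) ^ m := pow_le_pow_right₀ haB1 hm
        _ ≤ (aB n m c : ℝ) ^ m * (Mq X : ℝ) ^ m := mul_le_mul_of_nonneg_left hMm (by positivity)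
    linarith
  have h2 : ((aB n m c : ℝ) * Mq X) ^ m ≤ ((Bq n m c X : ℝ) + 1) ^ m :=
    pow_le_pow_left₀ (by positivity) hB1 m
  have key : (c : ℝ) * (Dq n m X : ℝ) * (Lq n m X : ℝ) ^ n <
      ((Tq n m X : ℝ) + 1) * ((Bq n m c X : ℝ) + 1) ^ m := by
    rw [hD]
    calc (c : ℝ) * (aD n m * Sq n m X) * (Lq n m X : ℝ) ^ n
        = ((Sq n m X : ℝ) / (n + 1)) * ((c : ℝ) * aD n m * (n + 1) * (Lq n m X : ℝ) ^ n) := by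
          field_simp
      _ < ((Sq n m X : ℝ) / (n + 1)) * ((aB n m c : ℝ) * Mq X) ^ m :=
          mul_lt_mul_of_pos_left h1 (by positivity)
      _ ≤ ((Tq n m X : ℝ) + 1) * ((Bq n m c X : ℝ) + 1) ^ m :=
          mul_le_mul hT h2 (by positivity) (by positivity)
  exact_mod_cast key

/-- **Second counting inequality, eventually**: `c Lⁿ < (T+1)(B+1)^{m-1}` (`m, n ≥ 1`).
[folklore] -/
theorem eventually_counting₂ (c : ℕ) (hn : 1 ≤ n) (hm : 1 ≤ m) :
    ∀ᶠ X in atTop, c * Lq n m X ^ n < (Tq n m X + 1) * (Bq n m c X + 1) ^ (m - 1) := by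
  obtain ⟨m', rfl⟩ : ∃ m', m = m' + 1 := ⟨m - 1, by omega⟩
  simp only [Nat.add_sub_cancel]
  have hpos : (0 : ℝ) < ((m' + 1 : ℕ) : ℝ) / n := by
    have : (0 : ℝ) < n := by exact_mod_cast hn
    positivity
  have hdom := eventually_mul_scale_le_of_lt (a := ((m' + 1 : ℕ) : ℝ))
    (a' := ((m' + 1 : ℕ) : ℝ) + ((m' + 1 : ℕ) : ℝ) / n)
    (by linarith) 0 0 (2 * (c : ℝ) * 2 ^ (m' + 2) * (n + 1))
  filter_upwards [eventually_M_ge, eventually_L_ge (n := n) (m := m' + 1) hn hm,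
    eventually_gt_atTop (1 : ℝ), hdom] with X hM hL hX1 hdomX
  obtain ⟨hMX, hM2⟩ := hM
  obtain ⟨hLX, hL2⟩ := hL
  have hX0 : (0 : ℝ) < X := by linarith
  have hLle : (Lq n (m' + 1) X : ℝ) ≤ scale (((m' + 1 : ℕ) : ℝ) / n) 0 X := L_le hX1.le
  obtain ⟨-, hsc2⟩ := scale_facts (m := m' + 1) hn hX1
  have hXm : scale (((m' + 1 : ℕ) : ℝ)) 0 X = X ^ (m' + 1) := by
    rw [scale, Real.rpow_zero, mul_one, Real.rpow_natCast]
  have hLn : (Lq n (m' + 1) X : ℝ) ^ n ≤ X ^ (m' + 1) := by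
    calc (Lq n (m' + 1) X : ℝ) ^ n ≤ scale (((m' + 1 : ℕ) : ℝ) / n) 0 X ^ n :=
          pow_le_pow_left₀ (Nat.cast_nonneg _) hLle n
      _ = X ^ (m' + 1) := by rw [hsc2, hXm]
  have hS : (Sq n (m' + 1) X : ℝ) = Lq n (m' + 1) X * Mq X := by unfold Sq; push_cast; ring
  have haB1 : (1 : ℝ) ≤ aB n (m' + 1) c := by exact_mod_cast one_le_aB (n := n) (m := m' + 1) (c := c)
  have hBM : (Mq X : ℝ) ≤ (Bq n (m' + 1) c X : ℝ) + 1 := by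
    have : (Bq n (m' + 1) c X : ℝ) = aB n (m' + 1) c * Mq X := by unfold Bq; push_cast; ring
    rw [this]
    calc (Mq X : ℝ) = 1 * Mq X := (one_mul _).symm
      _ ≤ aB n (m' + 1) c * Mq X := mul_le_mul_of_nonneg_right haB1 (Nat.cast_nonneg _)
      _ ≤ _ := by linarith
  -- the product `P = X^{m} X^{m/n}`
  set P : ℝ := X ^ (m' + 1) * scale (((m' + 1 : ℕ) : ℝ) / n) 0 X with hP
  have hPpos : 0 < P := mul_pos (by positivity) (scale_pos hX1)
  have hXpow : P = scale (((m' + 1 : ℕ) : ℝ) + ((m' + 1 : ℕ) : ℝ) / n) 0 X := by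
    rw [hP, ← hXm, scale_mul_scale hX1]; ring_nf
  -- lower bound for the right-hand side: `P/(2^{m+1}(n+1)) ≤ (T+1)(B+1)^{m-1}`
  have hR : P / (2 ^ (m' + 2) * (n + 1)) ≤
      ((Tq n (m' + 1) X : ℝ) + 1) * ((Bq n (m' + 1) c X : ℝ) + 1) ^ m' := by
    have hMm' : (X / 2) ^ m' ≤ ((Bq n (m' + 1) c X : ℝ) + 1) ^ m' :=
      pow_le_pow_left₀ (by positivity) (hMX.trans hBM) m'
    have hSlow : scale (((m' + 1 : ℕ) : ℝ) / n) 0 X / 2 * (X / 2) ≤ (Sq n (m' + 1) X : ℝ) := by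
      rw [hS]; exact mul_le_mul hLX hMX (by positivity) (Nat.cast_nonneg _)
    calc P / (2 ^ (m' + 2) * (n + 1))
        = (scale (((m' + 1 : ℕ) : ℝ) / n) 0 X / 2 * (X / 2)) / (n + 1) * (X / 2) ^ m' := by
          rw [hP, div_pow]; field_simp; ring
      _ ≤ ((Sq n (m' + 1) X : ℝ) / (n + 1)) * (X / 2) ^ m' := by
          refine mul_le_mul_of_nonneg_right ?_ (by positivity)
          exact div_le_div_of_nonneg_right hSlow (by positivity)
      _ ≤ ((Tq n (m' + 1) X : ℝ) + 1) * ((Bq n (m' + 1) c X : ℝ) + 1) ^ m' :=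
          mul_le_mul (S_div_le_T_succ X) hMm' (by positivity) (by positivity)
  -- upper bound for the left-hand side: `c Lⁿ ≤ c X^m ≤ P/(2·2^{m+1}(n+1)) < P/(2^{m+1}(n+1))`
  have hdom' : 2 * (c : ℝ) * 2 ^ (m' + 2) * (n + 1) * X ^ (m' + 1) ≤ P := by
    rw [hXpow, ← hXm]
    have := hdomX
    push_cast at this ⊢
    exact this
  have hq : (c : ℝ) * X ^ (m' + 1) ≤ P / (2 * 2 ^ (m' + 2) * (n + 1)) := by
    rw [le_div_iff₀ (by positivity)]
    calc (c : ℝ) * X ^ (m' + 1) * (2 * 2 ^ (m' + 2) * (n + 1))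
        = 2 * (c : ℝ) * 2 ^ (m' + 2) * (n + 1) * X ^ (m' + 1) := by ring
      _ ≤ P := hdom'
  have hlt : P / (2 * 2 ^ (m' + 2) * (n + 1)) < P / (2 ^ (m' + 2) * (n + 1)) := by
    refine div_lt_div_of_pos_left hPpos (by positivity) ?_
    have : (0 : ℝ) < 2 ^ (m' + 2) * (n + 1) := by positivity
    linarith
  have key : (c : ℝ) * (Lq n (m' + 1) X : ℝ) ^ n <
      ((Tq n (m' + 1) X : ℝ) + 1) * ((Bq n (m' + 1) c X : ℝ) + 1) ^ m' := by
    have hL' : (c : ℝ) * (Lq n (m' + 1) X : ℝ) ^ n ≤ c * X ^ (m' + 1) :=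
      mul_le_mul_of_nonneg_left hLn (Nat.cast_nonneg _)
    linarith
  exact_mod_cast key


/-! ### Crude upper bounds as powers of `X`, and the logarithm of the height -/

/-- `log x ≤ e log X` when `0 < x ≤ X^e` (`X > 1`). [folklore] -/
theorem log_le_of_le_scale {x e X : ℝ} (hX : 1 < X) (hx : 0 < x) (hle : x ≤ scale e 0 X) :
    Real.log x ≤ e * Real.log X := by
  rw [scale_zero_eq_exp e (by linarith)] at hle
  calc Real.log x ≤ Real.log (Real.exp (e * Real.log X)) := Real.log_le_log hx hle
    _ = e * Real.log X := Real.log_exp _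

/-- **Crude bounds, eventually**: `M ≤ X`, `L ≤ X^{m/n}`, `S ≤ X^{1+m/n}`, and
`D, b, D + nL, mM + 1 ≤ X^{2+m/n}`; also `S ≥ 4`. [folklore] -/
theorem eventually_crude (hn : 1 ≤ n) (hm : 1 ≤ m) :
    ∀ᶠ X in atTop, (Mq X : ℝ) ≤ X ∧ (Lq n m X : ℝ) ≤ scale ((m : ℝ) / n) 0 X ∧
      (Sq n m X : ℝ) ≤ scale (1 + (m : ℝ) / n) 0 X ∧
      (Dq n m X : ℝ) ≤ scale (2 + (m : ℝ) / n) 0 X ∧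
      (bq n m X : ℝ) ≤ scale (2 + (m : ℝ) / n) 0 X ∧
      ((Dq n m X : ℝ) + n * Lq n m X) ≤ scale (2 + (m : ℝ) / n) 0 X ∧
      ((m : ℝ) * Mq X + 1) ≤ scale (2 + (m : ℝ) / n) 0 X ∧
      4 ≤ Sq n m X := by
  have hpos : (0 : ℝ) ≤ (m : ℝ) / n := by positivity
  have h1 := eventually_mul_scale_le_of_lt (a := 1 + (m : ℝ) / n) (a' := 2 + (m : ℝ) / n)
    (by linarith) 0 0 ((aD n m : ℝ) + cb n m + n)
  have h2 := eventually_mul_scale_le_of_lt (a := (1 : ℝ)) (a' := 2 + (m : ℝ) / n)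
    (by linarith) 0 0 ((m : ℝ) + 1)
  filter_upwards [eventually_M_ge, eventually_L_ge (n := n) (m := m) hn hm,
    eventually_gt_atTop (1 : ℝ), h1, h2] with X hM hL hX1 h1X h2X
  have hX0 : 0 ≤ X := by linarith
  have hMle : (Mq X : ℝ) ≤ X := M_le hX0
  have hLle : (Lq n m X : ℝ) ≤ scale ((m : ℝ) / n) 0 X := L_le hX1.le
  obtain ⟨hsc1, -⟩ := scale_facts (m := m) hn hX1
  have hS : (Sq n m X : ℝ) = Lq n m X * Mq X := by unfold Sq; push_cast; ring
  have hSle : (Sq n m X : ℝ) ≤ scale (1 + (m : ℝ) / n) 0 X := by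
    rw [hS, ← hsc1]
    exact mul_le_mul hLle hMle (Nat.cast_nonneg _) (scale_nonneg hX1.le)
  have hs0 : 0 ≤ scale (1 + (m : ℝ) / n) 0 X := scale_nonneg hX1.le
  have haD : (1 : ℝ) ≤ aD n m := by exact_mod_cast one_le_aD (n := n) (m := m)
  have hcb : (2 : ℝ) ≤ cb n m := by exact_mod_cast two_le_cb (n := n) (m := m)
  have hD : (Dq n m X : ℝ) = aD n m * Sq n m X := by unfold Dq; push_cast; ring
  have hb : (bq n m X : ℝ) = cb n m * Sq n m X := by unfold bq; push_cast; ring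
  have hbig : ((aD n m : ℝ) + cb n m + n) * (Sq n m X : ℝ) ≤ scale (2 + (m : ℝ) / n) 0 X :=
    (mul_le_mul_of_nonneg_left hSle (by positivity)).trans h1X
  have hSn : (0 : ℝ) ≤ Sq n m X := Nat.cast_nonneg _
  refine ⟨hMle, hLle, hSle, ?_, ?_, ?_, ?_, ?_⟩
  · rw [hD]; nlinarith
  · rw [hb]; nlinarith
  · rw [hD]
    have : (Lq n m X : ℝ) ≤ Sq n m X := by
      rw [hS]
      have hM1 : (1 : ℝ) ≤ Mq X := by exact_mod_cast (show 1 ≤ Mq X by omega)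
      nlinarith
    nlinarith
  · rw [scale_one_zero] at h2X
    have hM' : (m : ℝ) * Mq X + 1 ≤ ((m : ℝ) + 1) * X := by nlinarith
    exact hM'.trans h2X
  · unfold Sq
    calc 4 = 2 * 2 := by norm_num
      _ ≤ Lq n m X * Mq X := Nat.mul_le_mul hL.2 hM.2

/-- The constant `K_H = (#Var + n + 2 + a_D)(2 + m/n)` of the height bound. [folklore] -/
def KH (n m : ℕ) : ℝ := ((Fintype.card (Var n m) : ℝ) + n + 2 + aD n m) * (2 + (m : ℝ) / n)

set_option maxHeartbeats 800000 in
/-- **The logarithmic height of Siegel's solution**: `log H ≤ K_H Φ(X)` eventually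
(`H = #Unk (D+nL)^S (mM+1)^D`, `Φ = X^{1+m/n} log X`). [folklore] -/
theorem eventually_log_Hgt3_le (hn : 1 ≤ n) (hm : 1 ≤ m) :
    ∀ᶠ X in atTop, 1 ≤ Hgt3 n m X ∧ Real.log (Hgt3 n m X) ≤ KH n m * Phi3 n m X := by
  have hpos : (0 : ℝ) < 1 + (m : ℝ) / n := by positivity
  filter_upwards [eventually_crude (n := n) (m := m) hn hm, eventually_gt_atTop (1 : ℝ),
    eventually_const_le_scale (a := 1 + (m : ℝ) / n) (b := 1) (Or.inl hpos) 1,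
    eventually_ge_atTop (Real.exp 1)] with X hc hX1 hΦ1 hXe
  obtain ⟨hMle, hLle, hSle, hDle, hble, hDLle, hMmle, hS4⟩ := hc
  set e : ℝ := 2 + (m : ℝ) / n with he
  set V : ℕ := Fintype.card (Var n m) with hV
  have hlogX : 0 < Real.log X := Real.log_pos hX1
  have hΦ : Phi3 n m X = scale (1 + (m : ℝ) / n) 0 X * Real.log X := by
    rw [Phi3, scale, scale, Real.rpow_zero, Real.rpow_one, mul_one]
  have hs0 : 0 ≤ scale (1 + (m : ℝ) / n) 0 X := scale_nonneg hX1.le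
  have hΦ0 : 0 ≤ Phi3 n m X := by rw [hΦ]; positivity
  -- positivity of the pieces
  have hS1 : (1 : ℝ) ≤ Sq n m X := by exact_mod_cast (show 1 ≤ Sq n m X by omega)
  have hL1 : (1 : ℝ) ≤ Lq n m X := by
    have : 1 ≤ Lq n m X := by
      by_contra h
      have h0 : Lq n m X = 0 := by omega
      have : Sq n m X = 0 := by unfold Sq; rw [h0, zero_mul]
      omega
    exact_mod_cast this
  have haD : (1 : ℝ) ≤ aD n m := by exact_mod_cast one_le_aD (n := n) (m := m)
  have hcb : (1 : ℝ) ≤ cb n m := by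
    have := two_le_cb (n := n) (m := m); exact_mod_cast (show 1 ≤ cb n m by omega)
  have hD1 : (1 : ℝ) ≤ Dq n m X := by
    have : (Dq n m X : ℝ) = aD n m * Sq n m X := by unfold Dq; push_cast; ring
    rw [this]; nlinarith
  have hb1 : (1 : ℝ) ≤ bq n m X := by
    have : (bq n m X : ℝ) = cb n m * Sq n m X := by unfold bq; push_cast; ring
    rw [this]; nlinarith
  have hDL1 : (1 : ℝ) ≤ (Dq n m X : ℝ) + n * Lq n m X := by
    have : (0 : ℝ) ≤ n * Lq n m X := by positivity
    linarith
  have hMm1 : (1 : ℝ) ≤ (m : ℝ) * Mq X + 1 := by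
    have : (0 : ℝ) ≤ (m : ℝ) * Mq X := by positivity
    linarith
  -- logarithms of the pieces are `≤ e log X`
  have lD := log_le_of_le_scale hX1 (by linarith) hDle
  have lL : Real.log (Lq n m X) ≤ e * Real.log X := by
    refine (log_le_of_le_scale hX1 (by linarith) hLle).trans ?_
    rw [he]; nlinarith
  have lb := log_le_of_le_scale hX1 (by linarith) hble
  have lDL := log_le_of_le_scale hX1 (by linarith) hDLle
  have lMm := log_le_of_le_scale hX1 (by linarith) hMmle
  -- the height
  have hcard : (Fintype.card (Unk n m (Dq n m X) (Lq n m X) (bq n m X)) : ℝ) =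
      (Dq n m X : ℝ) * (Lq n m X : ℝ) ^ n * (bq n m X : ℝ) ^ V := by
    rw [card_Unk, hV]; push_cast; ring
  have hH : Hgt3 n m X = (Dq n m X : ℝ) * (Lq n m X : ℝ) ^ n * (bq n m X : ℝ) ^ V *
      ((((Dq n m X : ℕ) : ℝ) + n * Lq n m X) ^ Sq n m X * ((m : ℝ) * Mq X + 1) ^ Dq n m X) := by
    rw [Hgt3, hcard]
  have hH1 : 1 ≤ Hgt3 n m X := by
    rw [hH]
    have h1 : (1 : ℝ) ≤ (Dq n m X : ℝ) * (Lq n m X : ℝ) ^ n * (bq n m X : ℝ) ^ V :=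
      one_le_mul_of_one_le_of_one_le (one_le_mul_of_one_le_of_one_le hD1 (one_le_pow₀ hL1))
        (one_le_pow₀ hb1)
    have h2 : (1 : ℝ) ≤ (((Dq n m X : ℕ) : ℝ) + n * Lq n m X) ^ Sq n m X * ((m : ℝ) * Mq X + 1) ^ Dq n m X :=
      one_le_mul_of_one_le_of_one_le (one_le_pow₀ hDL1) (one_le_pow₀ hMm1)
    exact one_le_mul_of_one_le_of_one_le h1 h2
  refine ⟨hH1, ?_⟩
  rw [hH, Real.log_mul (by positivity) (by positivity), Real.log_mul (by positivity) (by positivity),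
    Real.log_mul (by positivity) (by positivity), Real.log_mul (by positivity) (by positivity),
    Real.log_pow, Real.log_pow, Real.log_pow, Real.log_pow]
  -- collect: `(1 + n + V) e log X + S e log X + D e log X ≤ K_H Φ`
  have helog : 0 ≤ e * Real.log X := by positivity
  have hSΦ : (Sq n m X : ℝ) * (e * Real.log X) ≤ e * Phi3 n m X := by
    rw [hΦ]
    calc (Sq n m X : ℝ) * (e * Real.log X) ≤ scale (1 + (m : ℝ) / n) 0 X * (e * Real.log X) :=
          mul_le_mul_of_nonneg_right hSle helog
      _ = e * (scale (1 + (m : ℝ) / n) 0 X * Real.log X) := by ring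
  have hDΦ : (Dq n m X : ℝ) * (e * Real.log X) ≤ (aD n m : ℝ) * e * Phi3 n m X := by
    have hD' : (Dq n m X : ℝ) = aD n m * Sq n m X := by unfold Dq; push_cast; ring
    rw [hD']
    calc (aD n m : ℝ) * Sq n m X * (e * Real.log X) = aD n m * ((Sq n m X : ℝ) * (e * Real.log X)) := by ring
      _ ≤ aD n m * (e * Phi3 n m X) := mul_le_mul_of_nonneg_left hSΦ (by positivity)
      _ = (aD n m : ℝ) * e * Phi3 n m X := by ring
  have hlogΦ : Real.log X ≤ Phi3 n m X := by
    -- `log X ≤ X^{1+m/n} log X` since `X^{1+m/n} ≥ 1`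
    rw [hΦ]
    have h1s : 1 ≤ scale (1 + (m : ℝ) / n) 0 X := by
      rw [scale_zero_eq_exp _ (by linarith)]
      exact Real.one_le_exp (by positivity)
    calc Real.log X = 1 * Real.log X := (one_mul _).symm
      _ ≤ scale (1 + (m : ℝ) / n) 0 X * Real.log X := mul_le_mul_of_nonneg_right h1s hlogX.le
  have hVe : 0 ≤ e := by rw [he]; positivity
  have hK : KH n m = ((V : ℝ) + n + 2 + aD n m) * e := by rw [KH, hV, he]
  rw [hK]
  have hn0 : (0 : ℝ) ≤ n := Nat.cast_nonneg n
  have hV0 : (0 : ℝ) ≤ V := Nat.cast_nonneg V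
  have heΦ : e * Real.log X ≤ e * Phi3 n m X := mul_le_mul_of_nonneg_left hlogΦ hVe
  have t1 : Real.log (Dq n m X) ≤ e * Phi3 n m X := lD.trans heΦ
  have t2 : (n : ℝ) * Real.log (Lq n m X) ≤ n * (e * Phi3 n m X) :=
    mul_le_mul_of_nonneg_left (lL.trans heΦ) hn0
  have t3 : (V : ℝ) * Real.log (bq n m X) ≤ V * (e * Phi3 n m X) :=
    mul_le_mul_of_nonneg_left (lb.trans heΦ) hV0
  have t4 : (Sq n m X : ℝ) * Real.log ((Dq n m X : ℝ) + n * Lq n m X) ≤ e * Phi3 n m X :=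
    (mul_le_mul_of_nonneg_left lDL (by positivity)).trans hSΦ
  have t5 : (Dq n m X : ℝ) * Real.log ((m : ℝ) * Mq X + 1) ≤ (aD n m : ℝ) * e * Phi3 n m X :=
    (mul_le_mul_of_nonneg_left lMm (by positivity)).trans hDΦ
  have : Real.log (Dq n m X) + n * Real.log (Lq n m X) + V * Real.log (bq n m X) +
      ((Sq n m X : ℝ) * Real.log ((Dq n m X : ℝ) + n * Lq n m X) +
        (Dq n m X : ℝ) * Real.log ((m : ℝ) * Mq X + 1)) ≤ ((V : ℝ) + n + 2 + aD n m) * e * Phi3 n m X := by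
    have : ((V : ℝ) + n + 2 + aD n m) * e * Phi3 n m X =
        e * Phi3 n m X + n * (e * Phi3 n m X) + V * (e * Phi3 n m X) +
          (e * Phi3 n m X + (aD n m : ℝ) * e * Phi3 n m X) := by ring
    rw [this]
    linarith
  convert this using 1

end DiazMainIII

end Literature.NumberTheory.Transcendental

end
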